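import Mathlib
import Summits.ResolutionOfSingularities.ResolutionOfSingularities.Theorems.SyzygyFlatteningDefs
import HarnessLib

/-!
# Syzygy-flattening tower: the ring of a non-trivial real-valued valuation has two overrings

Stub `stub_realValued_twoOverrings` of the crux `HigherRankTermination` (line `birth`,
base-change line): if `w : L → ℝ≥0` is a valuation on a field `L`, `O'` is its ring
(`y ∈ O' ↔ w y ≤ 1`) and `w` is non-trivial (`1 < w y` for some `y`), then `O' ≠ ⊤` and the only
valuation subrings of `L` containing `O'` are `O'` and `⊤ = L` (`TwoOverrings O'`), i.e. `O'` is
"rank one" in the sense of the route.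

Proof (Matsumura, *Commutative Ring Theory*, Theorem 10.7, `⇒`; Zariski–Samuel VI §10): the value
group sits inside the archimedean group `ℝ>0`. (a) The element `y` with `w y > 1` is not in `O'`,
so `O' ≠ ⊤`. (b) If `O' ≤ S` and `S ≠ O'`, pick `s ∈ S ∖ O'`; then `w s > 1`, and for every
`b : L` archimedeanity of `ℝ≥0` (`pow_unbounded_of_one_lt`) gives `n` with `w b ≤ (w s) ^ n`, so
`b / s ^ n ∈ O' ⊆ S` and `b = (b / s ^ n) * s ^ n ∈ S`; hence `S = ⊤`. The argument is the one
of `Literature.AlgebraicGeometry.Resolution.isRankOne_of_isRankOneValued`, restated for an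
abstract `ℝ≥0`-valued valuation.
-/

noncomputable section

-- single-problem summit: the doubled namespace component is forced
set_option linter.dupNamespace false

open scoped NNReal

namespace Summit.ResolutionOfSingularities.ResolutionOfSingularities.Theorems.SyzygyFlattening

/-- The ring `O' = {w ≤ 1}` of a non-trivial valuation `w` (some `y` has `w y > 1`) is not the
whole field: that `y` is not in `O'`. [folklore] -/
theorem realValuedTwoOverrings_ne_top {L : Type} [Field L] (w : Valuation L ℝ≥0)
    (O' : ValuationSubring L) (hO' : ∀ y : L, w y ≤ 1 ↔ y ∈ O') (hy : ∃ y : L, 1 < w y) :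
    O' ≠ ⊤ := by
  rintro rfl
  obtain ⟨y, hy⟩ := hy
  exact not_le.mpr hy ((hO' y).mpr (ValuationSubring.mem_top y))

/-- **Archimedean value group ⇒ only two overrings.** If `O' = {w ≤ 1}` for a valuation
`w : L → ℝ≥0`, every valuation subring `S ⊇ O'` is `O'` or `⊤`: an element `s ∈ S ∖ O'` has
`w s > 1` and absorbs every `b` (`w b ≤ (w s) ^ n`, so `b = (b / s ^ n) * s ^ n ∈ S`).
[cite: Matsumura1987, Theorem 10.7] -/
theorem realValuedTwoOverrings_twoOverrings {L : Type} [Field L] (w : Valuation L ℝ≥0)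
    (O' : ValuationSubring L) (hO' : ∀ y : L, w y ≤ 1 ↔ y ∈ O') : TwoOverrings O' := by
  intro S hS
  by_cases hSO : S = O'
  · exact Or.inl hSO
  · right
    -- an element of `S` outside `O'`
    obtain ⟨s, hsS, hsO⟩ : ∃ s : L, s ∈ S ∧ s ∉ O' := by
      by_contra hcon
      push Not at hcon
      exact hSO (le_antisymm (fun s hs => hcon s hs) hS)
    have hvs : 1 < w s := not_le.mp fun hle => hsO ((hO' s).mp hle)
    have hs0 : s ≠ 0 := by
      rintro rfl
      rw [map_zero] at hvs
      exact not_lt.mpr zero_le_one hvs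
    refine eq_top_iff.mpr fun b _ => ?_
    -- archimedeanity of `ℝ≥0`
    obtain ⟨n, hn⟩ := pow_unbounded_of_one_lt (w b) hvs
    -- `b / s ^ n ∈ O' ⊆ S`
    have hq : b / s ^ n ∈ O' := by
      rw [← hO', map_div₀, map_pow]
      exact div_le_one_of_le₀ hn.le zero_le
    have hsn : s ^ n ∈ S := pow_mem hsS n
    have hsn0 : s ^ n ≠ 0 := pow_ne_zero n hs0
    have hb : b = b / s ^ n * s ^ n := (div_mul_cancel₀ b hsn0).symm
    rw [hb]
    exact S.mul_mem _ _ (hS hq) hsn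

/-- **Stub `stub_realValued_twoOverrings`.** The ring `O'` of a non-trivial real-valued valuation
`w` on a field `L` (`y ∈ O' ↔ w y ≤ 1`, some `w y > 1`) is a proper valuation subring whose only
overrings are `O'` and `L`: rank one, because the value group is archimedean.
[cite: Matsumura1987, Theorem 10.7] -/
theorem stub_realValued_twoOverrings : ∀ (L : Type) [Field L] (w : Valuation L ℝ≥0)
    (O' : ValuationSubring L), (∀ y : L, w y ≤ 1 ↔ y ∈ O') → (∃ y : L, 1 < w y) →
      O' ≠ ⊤ ∧ TwoOverrings O' := by
  intro L _ w O' hO' hy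
  exact ⟨realValuedTwoOverrings_ne_top w O' hO' hy, realValuedTwoOverrings_twoOverrings w O' hO'⟩

end Summit.ResolutionOfSingularities.ResolutionOfSingularities.Theorems.SyzygyFlattening

end
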